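import Summits.Ventures.PercRepro.Night2LocalD2CoverPair

/-!
# PercRepro — the pair-5 rule at `q = 4`, `|E ∖ G| = 2`: definitions and rows (night-2, gen 14)

`localShadowHall_d2_of_three_le` (Night2LocalD2CoverPair) settles the rank-5 flats with `|E ∖ G| = 2` all of whose
members have `|G ∖ cl B| ≥ 3`.  The companion file Night2LocalD2OnePair admits the members with `|G ∖ cl B| = 2` — those whose closure is a
hyperplane `H` of `M|G` missing exactly two points, i.e. `G ∖ H` a 2-cocircuit of `M|G` — provided they all share
ONE closure (`M|G` has at most one 2-cocircuit carrying members), and no member has `|G ∖ cl B| = 1` (no coloop of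
`M|G` carries members):

**`localShadowHall_d2_of_one_pair`** — `G ∈ flatsQ M 5`, `|E ∖ G| = 2`, every member `B` below `G` has
`|G ∖ cl B| ≥ 2`, and any two members with `|G ∖ cl B| = 2` have the same closure ⟹ `LocalShadowHall M 4 G`.

This file defines the rule and proves its rows.  The rule (`opW`, the «pair-5 rule»): every member with
`m := |G ∖ cl B| ≤ 3` takes `1/5` from each covering set,
thinner members take `Φ/|E ∖ cl B| ≤ 1/5`; an `m = 3` member takes `1/25` from each of its three pair sets (`cpPair`
of the companion file), an `m = 2` member takes `1/5` from its far set `B ∪ (G ∖ cl B)` (`opFar`).  Rows: `2/5 + 1/5`,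
`3/5 + 3/25`, `m·Φ/(m+2)` = the local demands `Φ·m/(m+2)`.  Columns at a shadow set `S` with `κ₀` coloops: `≤ κ₀/5`
from the covering preimages; the pair and far preimages `B` have `S ∖ B` a series pair of `S` (`card_pairPre_le`),
at most one of them is a far preimage (two far preimages `B, B'` have `S ∖ B = G ∖ cl B = G ∖ cl B' = S ∖ B'`), so
with `P := #seriesPairs S`, `2P ≤ (6−κ₀)(5−κ₀)`, the column is `≤ κ₀/5 + P/25 + (4/25)·[far]`, and a far preimage
forces `P ≥ 1`, hence `κ₀ ≤ 4`: at most `1` in every case (`op_col_arith`).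

Numerics (mining/night-2/g14/pair5series.py, pair5stats.py): the pair-5 rule is a matching on every coloop-free
flat whose series classes have ≤ 3 elements (0 overloads on direct sums, random / planted GF(2), GF(3), GF(5) flats
≤ 12 points, the fan), and fails exactly on the series class of size 4 (`G = ℓ ⊕ U_{3,4}`, a far set with six
`m = 2` members) — where the covering certificate `localShadowHall_of_cover_sum` applies instead (three preimages
of `1/|E ∖ cl B| = 1/4` per set).  The present theorem is the sub-case with at most one far preimage per set.
-/

namespace PercRepro.Shadow

open Finset PerFlat ThmH

variable {α : Type*} [DecidableEq α] {M : Matroid α} [M.Finite]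

/-! ## The rule -/

/-- The covering weight of the pair-5 rule: `1/5` for `|G ∖ cl B| ≤ 3`, else `(6/5)/|E ∖ cl B|`. -/
noncomputable def opCov (M : Matroid α) [M.Finite] (G B : Finset α) : ℚ :=
  if (G \ clF M B).card ≤ 3 then 1 / 5 else ((6 : ℚ) / 5) / ((gr M \ clF M B).card : ℚ)

open scoped Classical in
/-- The far weight: `1/5` on the far set `B ∪ (G ∖ cl B)` of a member with `|G ∖ cl B| = 2`. -/
noncomputable def opFar (M : Matroid α) [M.Finite] (G B S : Finset α) : ℚ :=
  if (G \ clF M B).card = 2 ∧ S = B ∪ (G \ clF M B) then 1 / 5 else 0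

open scoped Classical in
/-- The pair-5 rule at `q = 4`, `|E ∖ G| = 2`. -/
noncomputable def opW (M : Matroid α) [M.Finite] (G B S : Finset α) : ℚ :=
  (if B ∈ membersIn M (Uq M (4 + 2) 4) G ∧ S ∈ coverSets M B G then opCov M G B else 0) +
  (if B ∈ membersIn M (Uq M (4 + 2) 4) G then
    ∑ P ∈ Finset.powersetCard 2 (G \ clF M B), (if S = B ∪ P then cpPair M 4 G B else 0) else 0) +
  (if B ∈ membersIn M (Uq M (4 + 2) 4) G then opFar M G B S else 0)

/-! ## Basic facts -/

/-- `opCov ≥ 0`. -/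
theorem opCov_nonneg (G B : Finset α) : 0 ≤ opCov M G B := by
  unfold opCov
  split_ifs <;> positivity

open scoped Classical in
/-- `opFar ≥ 0`. -/
theorem opFar_nonneg (G B S : Finset α) : 0 ≤ opFar M G B S := by
  unfold opFar
  split_ifs <;> norm_num

open scoped Classical in
/-- `opW ≥ 0`. -/
theorem opW_nonneg (G B S : Finset α) : 0 ≤ opW M G B S := by
  unfold opW
  refine add_nonneg (add_nonneg ?_ ?_) ?_
  · split_ifs
    · exact opCov_nonneg G B
    · exact le_refl _
  · split_ifs
    · apply Finset.sum_nonneg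
      intro P _
      split_ifs
      · exact cpPair_nonneg 4 G B
      · exact le_refl _
    · exact le_refl _
  · split_ifs
    · exact opFar_nonneg G B S
    · exact le_refl _

/-- `opCov ≤ 1/5` for a member with `|E ∖ cl B| = |G ∖ cl B| + 2` and `|G ∖ cl B| ≥ 2`. -/
theorem opCov_le {G B : Finset α} (hc : (gr M \ clF M B).card = (G \ clF M B).card + 2) :
    opCov M G B ≤ 1 / 5 := by
  unfold opCov
  split_ifs with h
  · exact le_refl _
  · push Not at h
    have h6 : 6 ≤ (gr M \ clF M B).card := by omega
    have h6' : (6 : ℚ) ≤ ((gr M \ clF M B).card : ℚ) := by exact_mod_cast h6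
    rw [div_le_div_iff₀ (by positivity) (by norm_num)]
    linarith

/-- `cpPair M 4 G B ≤ 1/25` for a member with `|E ∖ cl B| = |G ∖ cl B| + 2` (it is `1/25` at `|G ∖ cl B| = 3`,
`0` elsewhere). -/
theorem cpPair_four_le {G B : Finset α} (hc : (gr M \ clF M B).card = (G \ clF M B).card + 2) :
    cpPair M 4 G B ≤ 1 / 25 := by
  unfold cpPair
  split_ifs with h
  · have hm : (G \ clF M B).card = 3 := by omega
    rw [hm]
    norm_num
  · norm_num

/-! ## Rows -/

open scoped Classical in
/-- The far set of an `m = 2` member is a shadow set with closure `G`. -/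
theorem far_mem_shadowAt {G : Finset α} (hG : G ∈ flatsQ M (4 + 1)) {B : Finset α}
    (hB : B ∈ membersIn M (Uq M (4 + 2) 4) G) (h2 : (G \ clF M B).card = 2) :
    B ∪ (G \ clF M B) ∈ shadowAt M (4 + 2) 4 (Uq M (4 + 2) 4) G :=
  union_pair_mem_shadowAt (le_refl _) hG hB (by rw [Finset.mem_powersetCard]; exact ⟨le_refl _, h2⟩)

open scoped Classical in
/-- The row sum of a member under the pair-5 rule. -/
theorem sum_opW_row {G : Finset α} (hG : G ∈ flatsQ M (4 + 1)) {B : Finset α}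
    (hB : B ∈ membersIn M (Uq M (4 + 2) 4) G) :
    ∑ S ∈ shadowAt M (4 + 2) 4 (Uq M (4 + 2) 4) G, opW M G B S =
      ((G \ clF M B).card : ℚ) * opCov M G B + (((G \ clF M B).card.choose 2 : ℕ) : ℚ) * cpPair M 4 G B +
        (if (G \ clF M B).card = 2 then 1 / 5 else 0) := by
  have hBU : B ∈ Uq M (4 + 2) 4 := (mem_membersIn.1 hB).1
  unfold opW
  rw [Finset.sum_add_distrib, Finset.sum_add_distrib]
  congr 1
  · congr 1
    · simp only [hB, true_and]
      rw [← Finset.sum_filter]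
      have h1 : (shadowAt M (4 + 2) 4 (Uq M (4 + 2) 4) G).filter (fun S => S ∈ coverSets M B G) =
          coverSets M B G := by
        ext S
        rw [Finset.mem_filter]
        exact ⟨fun h => h.2, fun h => ⟨coverSets_subset_shadowAt (le_refl _) hG hB h, h⟩⟩
      rw [h1, Finset.sum_const, card_coverSets hBU, nsmul_eq_mul]
    · simp only [hB, if_true]
      rw [Finset.sum_comm]
      have h2 : ∀ P ∈ Finset.powersetCard 2 (G \ clF M B),
          ∑ S ∈ shadowAt M (4 + 2) 4 (Uq M (4 + 2) 4) G, (if S = B ∪ P then cpPair M 4 G B else 0) =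
            cpPair M 4 G B := by
        intro P hP
        rw [Finset.sum_ite_eq']
        simp only [union_pair_mem_shadowAt (le_refl _) hG hB hP, if_true]
      rw [Finset.sum_congr rfl h2, Finset.sum_const, Finset.card_powersetCard, nsmul_eq_mul]
  · simp only [hB, if_true]
    unfold opFar
    split_ifs with h2
    · simp only [h2, true_and]
      rw [Finset.sum_ite_eq']
      simp only [far_mem_shadowAt hG hB h2, if_true]
    · simp only [h2, false_and, if_false, Finset.sum_const_zero]

/-- The row sum dominates the local demand (members with `|G ∖ cl B| ≥ 2`, `|E ∖ cl B| = |G ∖ cl B| + 2`). -/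
theorem row_opW_ge {G : Finset α} (hG : G ∈ flatsQ M (4 + 1)) {B : Finset α}
    (hB : B ∈ membersIn M (Uq M (4 + 2) 4) G) (hc : (gr M \ clF M B).card = (G \ clF M B).card + 2)
    (hm : 2 ≤ (G \ clF M B).card) :
    (((4 : ℕ) : ℚ) + 2) / (((4 : ℕ) : ℚ) + 1) * localWeight M B G ≤
      ∑ S ∈ shadowAt M (4 + 2) 4 (Uq M (4 + 2) 4) G, opW M G B S := by
  classical
  rw [sum_opW_row hG hB]
  unfold localWeight opCov cpPair
  rw [hc]
  obtain ⟨m, hm'⟩ : ∃ m, (G \ clF M B).card = m := ⟨_, rfl⟩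
  rw [hm'] at hm ⊢
  rcases Nat.lt_or_ge m 4 with hlt | hge
  · -- `m ∈ {2, 3}`
    have hm2 : m = 2 ∨ m = 3 := by omega
    rcases hm2 with rfl | rfl
    · norm_num
    · norm_num
  · -- `m ≥ 4`: `m · (6/5)/(m+2) = Φ · m/(m+2)`
    have h3 : ¬ m ≤ 3 := by omega
    have h5 : ¬ (m + 2 = 4 + 1) := by omega
    have h2 : ¬ (m = 2) := by omega
    simp only [h3, h5, h2, if_false, mul_zero, add_zero]
    push_cast
    have hpos : (0 : ℚ) < (m : ℚ) + 2 := by positivity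
    field_simp
    ring_nf
    exact le_refl _

end PercRepro.Shadow
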